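import Literature.MathematicalPhysics.QuantumFieldTheory.Balaban1983to89.B9Thm311ClassCompactnessZdPer
import Literature.MathematicalPhysics.QuantumFieldTheory.Balaban1983to89.B8PeriodicMemberGeometry
import Literature.MathematicalPhysics.QuantumFieldTheory.Balaban1983to89.B8Eq15ClassGraphConnectedZd

/-!
# `Balaban1983to89.B9Thm311FlatHolonomyKernelZdPerNested` — [Balaban1985BackgroundPropagators] THEOREM 3.11 AT EVERY FLAT PERIODIC BACKGROUND OF EVERY
# NESTED PERIODIC MEMBER (print's class (1.31) `towerBondsP`, every truncation `m ≤ k`), ARBITRARY HOLONOMY: for the genuine four-letter record `opsAllZdPer` on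
# the Hermitian periodic carrier `E_𝔤^per(P)`, `Δ_a(U₀)` is POSITIVE DEFINITE — hence `RegularAtHPer` — at every `P`-periodic unitary `U₀` with all plaquette variables
# `1`; plus «`Q′` is onto» (`Q′*` injective) for multi-level constraint families with disjoint blocks.  The all-torus member (`B9Thm311FlatHolonomyKernelZdPer`,
# dag-n06-b g23) generalised through the connectivity theorem `B8Eq15ClassGraphConnectedZd`

statement-level skeleton of published theorems with citation tags; proofs where landed; nothing here is a claim about the Yang–Mills mass gap

`[Balaban1985BackgroundPropagators]` ("B9", CMP **99** (1985) 389–434) Thm 3.11 p. 416 *«the operators Δ′_a, G′, (Q′G′²Q′*)⁻¹, Δ_a, G are positive definite … uniformly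
in U, Ω_j»* (stated for all backgrounds of the class (3.35), which contains flat backgrounds with holonomy), (3.18)–(3.19) p. 393, (3.21)–(3.25) p. 394, (3.26)–(3.27)
p. 395, (3.28)–(3.34) pp. 395–396 (gauge covariance of every letter), (3.115) p. 418 «Q_j d = D_j Q′_j».  `[Balaban1985Averaging]` ("B7", CMP **98**) (8)–(11) pp. 18–19,
pp. 24–25 (the axial gauge), (2)–(3) p. 17, (212) p. 50.  `[Balaban1984PropagatorsI]` (1.72) p. 30.  `[Balaban1985RegularSpaces]` ("B8") (1.3)–(1.6) p. 77, (1.7) p. 77,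
(1.28) p. 81, (1.31) p. 82, (1.58) p. 86, p. 77 (*«Ω_j ⊂ T_η … we admit the case where some domains Ω_j are equal to T_η»*).

CITATION HEADER (lean-in-tree rule).  Cell `pub-ymgap` (YM Track A, HUMAN RULINGS D-0062 ∕ D-0149), node N06 = [B9]; seat `pub-ymgap-dag-n06-b` (g25), junction ∕ letter
lineage of J-N06→N05 and owner of the N06 object layer of the (β′-PERIODIC) road; own take of HANDOFF §2r (b) (the lineage's open successor item).  WHY.  The N05 witness
slot of record (R467, `…N05SubBP2DK2PerKappaSlotExistsOfBindersLettersPer(Door)`) displays NODE N06's five analytic binders at EVERY member `a : IdxB8SubDPerκ` of print's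
nested periodic class with the bond class `towerBondsP θ.L a.Ω (a.Λs k)`; the lineage's theorems inhabit them at the all-torus member `torusIdx` only, because the first
link — g23's flat-holonomy vector kernel — used the all-torus constraint class (every level-`m` bond a constraint bond; one active level for `Q′*`).  THIS FILE generalises
that first link to EVERY nested periodic member: §0 «`Q′` onto» for MULTI-LEVEL families from the disjointness of the constraint blocks ((1.5)–(1.6)); §1 the kernel
argument with the one torus-specific step («`Q_m(1)Ã ≡ 0` ⟹ block sums of `λ̃` constant on `ℤᵈ`») replaced by the CONNECTIVITY hypothesis that
`B8Eq15ClassGraphConnectedZd.exists_const_avg_of_towerBondsP` discharges, and the quasi-periodicity constants read off ONE periodic constraint label; §2 the record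
corollaries for a general class `𝔅` with level-periodic sections and the box law (p648517's kernel conditions are already generic); §3 the member theorems on
`IdxB8SubDPer θ P` with NO displayed binder.  The successor file `B9Thm311ClassCompactnessZdPerNested` re-bases dag-n06-b g24's openness + compactness road on these,
inhabiting the junction's `InvAtHIPer` per member.

WHAT IS PROVED (kernel, 0 sorry; theorems only (+ private plumbing); no `def`, no `instance`, no `notation`).
* §0 `QprimeT_eq_zero_of_apply_blockMap_eq_zero` (the iterated transpose `Q′_jᵀν` at a site reads `ν` only at the site's level-`j` label), ★★
  `qprimeStarPerInjective_of_disjoint_levels` («`Q′` ONTO» AT EVERY BACKGROUND OF UNITS when a site is in the block of a constraint label for at most one level `j ≤ m`;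
  dag-n06-w4's `qprimeStarPerInjective_of_single_level` is the one-level case).
* §1 ★★★ `eq_zero_of_flat_holonomy_kernel_of_connected` (general families `Λ`, classes `𝔅`, hypotheses `hconn` (connectivity) and one periodic label: `U₀` periodic
  unitary flat (any holonomy), `A ∈ E_𝔤^per(P)` closed, `R^per(U₀)D^{η*}_{U₀}A = 0`, `Q_j(U₀)A = 0` on `𝔅 j`, `j ≤ m` ⟹ `A = 0`).
* §2 ★★★ `eq_zero_of_flat_of_bondPairPer_deltaAOf_opsAllZdPer_nonpos_of_connected`, ★★★ `bondPairPer_deltaAOf_opsAllZdPer_pos_of_flat_of_connected`,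
  ★★ `regularAtHPer_opsAllZdPer_of_flat_of_connected` (the genuine periodic record over a general class: level-periodic `κ`-sections, box law, connectivity, a periodic
  label, `Lᵐ ∣ P`).
* §3 (members `a : IdxB8SubDPer θ P`, `m ≤ k`, print's class `towerBondsP θ.L Ω (Λs ·)`) `IdxB8SubDPer.isPeriodic_towerBondsP_Λs`, `IdxB8SubDPer.towerBondsP_box`,
  `IdxB8SubDPer.exists_periodic_label`, `IdxB8SubDPer.level_eq_of_inSat_blockMap`, ★★ `IdxB8SubDPer.qprimeStarPerInjective` (every background of units), ★★★
  `IdxB8SubDPer.eq_zero_of_flat_of_bondPairPer_deltaAOf_opsAllZdPer_nonpos`, ★★★ `IdxB8SubDPer.bondPairPer_deltaAOf_opsAllZdPer_pos_of_flat`, ★★★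
  `IdxB8SubDPer.regularAtHPer_opsAllZdPer_of_flat` — THEOREM 3.11 AT EVERY FLAT PERIODIC BACKGROUND OF EVERY NESTED PERIODIC MEMBER, NO DISPLAYED BINDER.

HONEST SCOPE.  (i) Theorem 3.11's positivity for the genuine periodic record at every FLAT periodic background of every nested periodic member (print's class); NOT at curved
backgrounds (openness + compactness — the successor file), no estimate, no uniformity, no coercivity constant.  (ii) Count-neutral (`--supports` the K1 item of record);
N06 NOT discharged; N05's discharge of record (R467) displays these binders as hypotheses — this file is a step toward inhabiting them, nothing more; K1⁹ NOT closed; counts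
UNMOVED; one finite `𝕋⁴` programme at fixed `ε`, Bałaban as printed; R4 closes only the conditional finite-`𝕋⁴` rung `BalabanLadder.UV` — nothing continuum ∕ ℝ⁴ ∕ OS ∕ mass
gap ∕ Clay.  Unit `pub-ymgap-dag-n06-b` (g25), 2026-08-28; NEW file importing this seat's `B9Thm311ClassCompactnessZdPer` (g24; transitively g23's kernel file and
dag-n06-w4's `B9Eq325QGGQInvZdPer`), dag-n05-w2's `B8PeriodicMemberGeometry`, this seat's `B8Eq15ClassGraphConnectedZd` (g25 FILE A); modifies nothing.  Net new unproved
facts: 0.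
-/

noncomputable section

open scoped BigOperators

namespace Literature.MathematicalPhysics.QuantumFieldTheory.Balaban1983to89.B9Thm311FlatHolonomyKernelZdPerNested

open Literature.MathematicalPhysics.QuantumLattice (blockSites)
open B7Prop1Explicit B7Eq78Linearization
open B7Prop2Explicit (unitaryUnits hol_mem_of)
open B7Prop4GeneralLevels (linCovIter)
open B7Prop4Flat (linQIter)
open B7AvgGaugeCovariance (uLev)
open B8Ineq132 (covDerivFwd covDeriv plaqF)
open B8Eq146AExpansion (plaqCovDeriv)
open B8Eq138LandauZd (covDivB covLap)
open B8LeafModelZd (ZdIdx)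
open B8Eq119TwistedAxial (bgT bgT_one)
open T4TermwiseTorus (IsPeriodic box mem_box tcls tlift tlift_mem_box)
open B9SupplySockB9P3ZdLetters (OpsZd deltaAOf)
open B9Eq327GreenZdHermPer (domSubHPer bondPairPer RegularAtHPer sum_box_pair_covDerivFwd_left isPeriodic_covDerivFwd)
open B9Eq321LandauProjectionZdPer (perSub formPer gaugeNullPer projEPer projRPer isPeriodic_covDivB covLap_mem_rangeGenPer rangeSubPer
  projEPer_apply_of_mem_range)
open B9Eq316AveragingTransposeZd (tauForm tauForm_apply)
open B9Thm311FlatHolonomyKernelZdPer (eq_of_forall_step_eq gaugeAct_axialFn_eq_one_of_flat gauge_add_period_of_gaugeAct_eq_one exists_potential_of_closed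
  linQIter_grad sum_blockSites_add_smul)
open B8TowerBondsPrinted (towerBondsP)
open Node00 (Stage3Params IdxB8SubD IdxB8SubDPer)

-- `Site` alone could resolve to the torus sites of `Setup.lean`; re-export the `ℤ^d` sites of `B7Prop1Explicit`.
export B7Prop1Explicit (Site)

variable {d : ℕ}

/-! ## §0  «`Q′` is onto» (`Q′*` injective) for MULTI-LEVEL constraint families whose blocks are disjoint — every background of units -/

section Injective

variable {𝔸 : Type*} [CStarAlgebra 𝔸] {P L : ℕ} [NeZero P] [NeZero L] {U₀ : Site d → Fin d → 𝔸ˣ} {m : ℕ} {Λs : ℕ → Set (Site d)}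

open Literature.MathematicalPhysics.QuantumLattice (blockMap blockMap_one)
open B8Eq138LandauZd (QprimeT qprimeT1 QT)
open B9Eq325QGGQInvZdPer (InSat levPer QprimeStarPer QprimeStarPerInjective QprimeStarPer_coe_apply_of_mem_box eq_zero_on_box_of_QprimeT_eq_zero neZero_div_pow)

omit [NeZero P] [NeZero L] in
/-- **THE ITERATED TRANSPOSE `Q′_jᵀν` AT A FINE SITE READS `ν` ONLY AT THE LABEL OF THE SITE'S `j`-BLOCK**: `ν(⌊x∕Lʲ⌋) = 0 ⟹ (Q′_jᵀν)(x) = 0` (each transpose step reads the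
datum at the block of the site, [Balaban1985BackgroundPropagators] (3.19)). [cite: Balaban1985BackgroundPropagators, (3.19) p.393, (3.25) p.394] -/
theorem QprimeT_eq_zero_of_apply_blockMap_eq_zero (L : ℕ) (U₀ : Site d → Fin d → 𝔸ˣ) :
    ∀ (j : ℕ) (ν : Site d → 𝔸) (x : Site d), ν (blockMap (L ^ j) x) = 0 → QprimeT L U₀ j ν x = 0
  | 0, ν, x, h => by
    rw [pow_zero, blockMap_one] at h
    exact h
  | j + 1, ν, x, h => by
    show QprimeT L U₀ j (qprimeT1 L U₀ j ν) x = 0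
    refine QprimeT_eq_zero_of_apply_blockMap_eq_zero L U₀ j _ x ?_
    rw [qprimeT1, B7BlockGeometry.blockMap_blockMap, ← pow_succ, h]
    simp [conjR_apply]

/-- ★★ **DISJOINT CONSTRAINT BLOCKS MAKE `Q′*` INJECTIVE AT EVERY BACKGROUND OF UNITS** (the nested members' geometry: a fine site lies in the block of a constraint label
`(j, ⌊x∕Lʲ⌋)`, `j ≤ m`, for AT MOST ONE level `j` — [Balaban1985RegularSpaces] (1.5)–(1.6), the partition `⋃_j Bʲ(Λ_j)`): then `Q′*φ = 0 ⟹ φ = 0` on `L²(𝔅_P, ·)`.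
At a site whose level-`j₀` label is a constraint label every other level's transpose term vanishes (§ `QprimeT_eq_zero_of_apply_blockMap_eq_zero`), so `Q′*φ = Q′_{j₀}ᵀφ_{j₀}`
there; elsewhere `Q′_{j₀}ᵀφ_{j₀}` vanishes anyway; so each `Q′_{j₀}ᵀφ_{j₀}` vanishes on the fine cell, hence `φ_{j₀}` on the level cell (`eq_zero_on_box_of_QprimeT_eq_zero`),
hence everywhere by level periodicity.  dag-n06-w4's `qprimeStarPerInjective_of_single_level` is the one-active-level case.
[cite: Balaban1985BackgroundPropagators, (3.18)–(3.19) p.393, (3.25) p.394; Balaban1985RegularSpaces, (1.5)–(1.6) p.77, (1.28) p.81, p.77 («Ω_j ⊂ T_η»)] -/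
theorem qprimeStarPerInjective_of_disjoint_levels (hP : L ^ m ∣ P)
    (hdisj : ∀ (x : Site d) (j j' : ℕ), j ≤ m → j' ≤ m → InSat P L Λs j (blockMap (L ^ j) x) → InSat P L Λs j' (blockMap (L ^ j') x) → j = j') :
    QprimeStarPerInjective (𝔸 := 𝔸) (d := d) P L U₀ m Λs := by
  intro φ ψ h
  rw [← sub_eq_zero] at h ⊢
  rw [← map_sub] at h
  set χ := φ - ψ with hχ
  -- each level's transpose vanishes on the fine cell
  have hlev : ∀ j₀, j₀ ≤ m → ∀ x ∈ box (d := d) P, QprimeT L U₀ j₀ (fun y => (χ : ℕ × Site d → 𝔸) (j₀, y)) x = 0 := by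
    intro j₀ hj₀ x hx
    by_cases hsat : InSat P L Λs j₀ (blockMap (L ^ j₀) x)
    · have hcell := congrArg (fun g : perSub (𝔸 := 𝔸) (d := d) P => (g : Site d → 𝔸) x) h
      simp only [Submodule.coe_zero, Pi.zero_apply] at hcell
      rw [QprimeStarPer_coe_apply_of_mem_box P L U₀ m Λs χ hx, QT,
        Finset.sum_eq_single j₀ (fun j hj hne => ?_) (fun h' => absurd (Finset.mem_range.2 (Nat.lt_succ_of_le hj₀)) h')] at hcell
      · rwa [Set.indicator_univ] at hcell
      · rw [Set.indicator_univ]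
        refine QprimeT_eq_zero_of_apply_blockMap_eq_zero L U₀ j _ x (χ.2.2 (j, _) fun h' => hne ?_)
        exact hdisj x j j₀ (Nat.lt_succ_iff.1 (Finset.mem_range.1 hj)) hj₀ h'.2 hsat
    · exact QprimeT_eq_zero_of_apply_blockMap_eq_zero L U₀ j₀ _ x (χ.2.2 (j₀, _) fun h' => hsat h'.2)
  -- hence each level datum vanishes on its level cell, hence everywhere by level periodicity
  apply Subtype.ext
  funext p
  obtain ⟨j, y⟩ := p
  rw [Submodule.coe_zero, Pi.zero_apply]
  by_cases hjm : j ≤ m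
  · haveI := neZero_div_pow (P := P) hP hjm
    have hbox := eq_zero_on_box_of_QprimeT_eq_zero (U₀ := U₀) j ((pow_dvd_pow L hjm).trans hP) _ (hlev j hjm)
    have hper : (χ : ℕ × Site d → 𝔸) (j, tlift (tcls (P / L ^ j) y)) = (χ : ℕ × Site d → 𝔸) (j, y) := IsPeriodic.apply_tlift (χ.2.1 j) y
    rw [← hper]
    exact hbox _ (tlift_mem_box _)
  · exact χ.2.2 (j, y) fun h' => hjm h'.1

end Injective

/-! ## §1  [B9] Theorem 3.11's kernel at a flat periodic background with ARBITRARY holonomy — GENERAL constraint families -/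

section Kernel

variable {𝔸 : Type*} [CStarAlgebra 𝔸] (τ : 𝔸 →ₗ[ℂ] ℂ) [FiniteDimensional ℝ 𝔸] [Nontrivial 𝔸] {L : ℕ} (P : ℕ) [NeZero P]

omit [FiniteDimensional ℝ 𝔸] [Nontrivial 𝔸] in
/-- `R(g)0 = 0`. [folklore] -/
private theorem conjR_zero' (g : 𝔸ˣ) : conjR g (0 : 𝔸) = 0 := by
  simp [conjR_apply]

omit [FiniteDimensional ℝ 𝔸] [Nontrivial 𝔸] in
/-- a real multiple of a Hermitian element is Hermitian. [cite: Balaban1985BackgroundPropagators, p.391 (𝔤-valued fields; bookkeeping)] -/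
private theorem smul_real_mem_selfAdjoint (r : ℝ) {a : 𝔸} (ha : IsSelfAdjoint a) : r • a ∈ selfAdjoint 𝔸 := by
  rw [selfAdjoint.mem_iff, ← Complex.coe_smul, star_smul, Complex.star_def, Complex.conj_ofReal, ha.star_eq]

omit [FiniteDimensional ℝ 𝔸] [Nontrivial 𝔸] in
/-- the axial gauge function is `1` at its base point (private copy of `B8Eq115GaugeFixing.axialFn_self`). [folklore] -/
private theorem axialFn_self' {G : Type*} [Group G] (V : Site d → Fin d → G) (y : Site d) : axialFn V y y = 1 := by
  simp [axialFn]

/-- ★★★ **[B9] THEOREM 3.11's KERNEL AT A FLAT PERIODIC BACKGROUND WITH ARBITRARY HOLONOMY — GENERAL CONSTRAINT FAMILIES** (any site families `Λ j`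
and bond classes `𝔅 j`, `j ≤ m`, whose CONSTRAINT GRAPH IS CONNECTED in the sense of `B8Eq15ClassGraphConnectedZd.exists_const_avg_of_towerBondsP` — the hypothesis
`hconn` — and which carry one constraint label `y₀ ∈ Λ j₀`, `L^{j₀} ∣ P`, together with all its period translates): for a `P`-periodic unitary `U₀` with every
plaquette variable `1` — NOT assumed gauge-equivalent to `1` — a field `A ∈ E_𝔤^per(P)` that is (a) covariantly closed, (b) has vanishing periodic Landau projection
`R^per(U₀)(D^{η*}_{U₀}A) = 0` for the gauge null space `N_𝔤^per(Q′(U₀))` of the families `Λ`, and (c) has `Q_j(U₀)A ≡ 0` on every class bond of `𝔅 j`, `j ≤ m`, VANISHES.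
ROUTE (the lineage's `B9Thm311FlatHolonomyKernelZdPer.eq_zero_of_flat_holonomy_kernel` with the one torus-specific step replaced): `U₀` is a pure gauge `g⁻¹dg` on `ℤᵈ`,
`g` quasi-periodic by the holonomies; `Ã = R(g)A` is flat-closed on `ℤᵈ`, hence `Ã = D¹λ̃` (Hermitian `λ̃`); (c) and (3.115) make the level-`j` BLOCK SUMS of `λ̃` equal at the
two ends of every class bond, so — CONNECTIVITY — `Q′_j(1)λ̃ ≡ c` on every `Λ j`, ONE constant; `λ̃(P•n) = c − R(h_n)c` from the one periodic label `y₀`; `μ := λ̃ − c` is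
exactly covariant-quasi-periodic and `Q′(1)`-null on every `Λ j`, so `μ^g := R(g)⁻¹μ ∈ N_𝔤^per(Q′(U₀))` with `Δ^η_{U₀}μ^g = D^{η*}_{U₀}A`; (b) kills it; the energy identity
gives `D^η_{U₀}μ^g = 0`, i.e. `A = 0`.
[cite: Balaban1985BackgroundPropagators, Thm 3.11 p.416, (3.21)–(3.23) p.394, (3.26)–(3.27) p.395, (3.32)–(3.34) pp.395–396, (3.115) p.418; Balaban1985RegularSpaces, (1.5) p.77, (1.31) p.82, p.77 («Ω_j ⊂ T_η»); Balaban1984PropagatorsI, (1.72) p.30; Balaban1985Averaging, (8)–(11) pp.18–19, pp.24–25] -/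
theorem eq_zero_of_flat_holonomy_kernel_of_connected (hτt : ∀ a b : 𝔸, τ (a * b) = τ (b * a))
    (hτs : ∀ a : 𝔸, τ (star a) = starRingEnd ℂ (τ a)) (hτp : ∀ a : 𝔸, a ≠ 0 → 0 < (τ (star a * a)).re)
    (hL : 1 ≤ L) {η : ℝ} (hη : η ≠ 0) {m : ℕ} (Λ : ℕ → Set (Site d)) (𝔅 : ℕ → Set (Site d × Fin d))
    (hconn : ∀ lam : Site d → 𝔸,
      (∀ j, j ≤ m → ∀ c ∈ 𝔅 j, ∑ x ∈ blockSites (L ^ j) (c.1 + e c.2), lam x = ∑ x ∈ blockSites (L ^ j) c.1, lam x) →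
      ∃ a : 𝔸, ∀ j, j ≤ m → ∀ y ∈ Λ j, ((L : ℝ) ^ (j * d))⁻¹ • ∑ x ∈ blockSites (L ^ j) y, lam x = a)
    {j₀ : ℕ} (hj₀ : j₀ ≤ m) (hdvd : L ^ j₀ ∣ P) {y₀ : Site d} (hy₀ : y₀ ∈ Λ j₀)
    (hy₀per : ∀ n : Site d, y₀ + ((P / L ^ j₀ : ℕ) : ℤ) • n ∈ Λ j₀)
    {U₀ : Site d → Fin d → 𝔸ˣ} (hU₀ : ∀ x κ, U₀ x κ ∈ unitaryUnits 𝔸) (hU : IsPeriodic P U₀)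
    (hflat : ∀ (κ ν : Fin d) (x : Site d), plaqF U₀ κ ν x = 1)
    {A : Site d → Fin d → 𝔸} (hA : A ∈ domSubHPer (d := d) (𝔸 := 𝔸) P)
    (ha : ∀ (μ ν : Fin d) (x : Site d), plaqCovDeriv η U₀ A μ ν x = 0)
    (hb : projRPer τ P L m η Λ U₀ (covDivB η U₀ A) = 0)
    (hc : ∀ j, j ≤ m → ∀ c ∈ 𝔅 j, linCovIter L U₀ A j c.1 c.2 = 0) : A = 0 := by
  classical
  have hU₀1 : ∀ x κ, U₀ x κ ∈ U1 𝔸 := fun x κ => B7Prop2Explicit.unitaryUnits_le_U1 (hU₀ x κ)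
  have hLpos : (0 : ℝ) < L := by exact_mod_cast (show 0 < L by omega)
  -- (A) the axial gauge trivialises the flat background
  set u : Site d → 𝔸ˣ := axialFn U₀ 0 with hu
  have hflatH : ∀ (x : Site d) (κ μ : Fin d), κ ≠ μ → hol U₀ x (plaqWord κ μ) = 1 := by
    intro x κ μ _
    exact Units.ext (by rw [Units.val_one]; exact hflat κ μ x)
  have hpure : gaugeAct u U₀ = 1 := gaugeAct_axialFn_eq_one_of_flat U₀ hflatH 0
  have huU : ∀ x, u x ∈ unitaryUnits 𝔸 := fun x => hol_mem_of hU₀ 0 _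
  have huinvU : ∀ x, u⁻¹ x ∈ unitaryUnits 𝔸 := B9Eq333ProjectionCovarianceZd.inv_mem_unitaryUnits huU
  have hu0 : u 0 = 1 := axialFn_self' U₀ 0
  have hU₀eq : U₀ = gaugeAct u⁻¹ (1 : Site d → Fin d → 𝔸ˣ) := by
    rw [← hpure, B9Eq333ProjectionCovarianceZd.gaugeAct_inv_gaugeAct]
  -- the holonomies of the cycles
  set h : Site d → 𝔸ˣ := fun n => u ((P : ℤ) • n) with hh
  have huper : ∀ (x n : Site d), u (x + (P : ℤ) • n) = h n * u x := by
    intro x n; rw [gauge_add_period_of_gaugeAct_eq_one hpure hU x n, hu0, inv_one, mul_one]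
  -- (B) the transformed field `Ã = R(u)A` on `ℤᵈ`
  set At : Site d → Fin d → 𝔸 := fun x κ => conjR (u x) (A x κ) with hAt
  have hAt_sa : ∀ x κ, IsSelfAdjoint (At x κ) := fun x κ => B9Eq333ProjectionCovarianceZd.isSelfAdjoint_conjR (huU x) (hA.2 x κ)
  have hAt_per : ∀ (x n : Site d) (κ : Fin d), At (x + (P : ℤ) • n) κ = conjR (h n) (At x κ) := by
    intro x n κ
    simp only [hAt]
    rw [show A (x + (P : ℤ) • n) κ = A x κ from congrFun (hA.1 x n) κ, huper, ← B8Ineq132.conjR_conjR]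
  have hAt_closed : ∀ (μ ν : Fin d) (x : Site d), plaqCovDeriv η (1 : Site d → Fin d → 𝔸ˣ) At μ ν x = 0 := by
    intro μ ν x
    have h1 := B8Ineq159GaugeCovariance.plaqCovDeriv_gaugeAct η u U₀ A μ ν x
    rw [hpure] at h1
    rw [hAt, h1, ha, conjR_zero']
  have hAt_lin : ∀ j, j ≤ m → ∀ c ∈ 𝔅 j, linCovIter L (1 : Site d → Fin d → 𝔸ˣ) At j c.1 c.2 = 0 := by
    intro j hj c hcm
    have h1 := B9Eq332FieldAvgCovariance.linCovIter_rot L u U₀ A j c.1 c.2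
    rw [hpure] at h1
    rw [hAt, h1, hc j hj c hcm, conjR_zero']
  -- closedness in difference form
  have hdiff : ∀ (x : Site d) (κ μ : Fin d), η • At x κ + η • At (x + e κ) μ = η • At x μ + η • At (x + e μ) κ := by
    intro x κ μ
    have h0 := hAt_closed κ μ x
    rw [B8Eq146AExpansion.plaqCovDeriv_eq_covDerivFwd, B8Eq191FlatStencils.covDerivFwd_flat_apply, B8Eq191FlatStencils.covDerivFwd_flat_apply,
      ← smul_sub, smul_eq_zero] at h0
    have h1 : At (x + e κ) μ - At x μ - (At (x + e μ) κ - At x κ) = 0 := h0.resolve_left (inv_ne_zero hη)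
    rw [← smul_add, ← smul_add]
    congr 1
    rw [← sub_eq_zero]
    rw [← sub_eq_zero] at h1
    rw [← h1]
    abel
  -- (F) the Hermitian potential on `ℤᵈ`
  obtain ⟨lt, hlt0, hltS, hgrad⟩ := exists_potential_of_closed (fun x κ => η • At x κ) hdiff (selfAdjoint 𝔸)
    (fun x κ => smul_real_mem_selfAdjoint η (hAt_sa x κ))
  have hgrad' : ∀ (x : Site d) (κ : Fin d), covDerivFwd η (1 : Site d → Fin d → 𝔸ˣ) κ lt x = At x κ := by
    intro x κ
    rw [B8Eq191FlatStencils.covDerivFwd_flat_apply, hgrad x κ, smul_smul, inv_mul_cancel₀ hη, one_smul]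
  have hAt_eq : At = fun x κ => ((η⁻¹ : ℝ) : ℂ) • (lt (x + e κ) - lt x) := by
    funext x κ
    rw [Complex.coe_smul, hgrad x κ, smul_smul, inv_mul_cancel₀ hη, one_smul]
  -- (G) the block sums of `λ̃` agree at the two ends of EVERY class bond …
  obtain ⟨M₀, hM₀, hAM⟩ := B9Thm311FlatPositivityZdPer.exists_bound_of_isPeriodic_bond P hA.1
  have hAtb : ∀ x κ', ‖At x κ'‖ ≤ M₀ := fun x κ' => by
    simp only [hAt]; rw [B8Ineq132.norm_conjR (B7Prop2Explicit.unitaryUnits_le_U1 (huU x))]; exact hAM x κ'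
  have hsums : ∀ j, j ≤ m → ∀ c ∈ 𝔅 j, ∑ x ∈ blockSites (L ^ j) (c.1 + e c.2), lt x = ∑ x ∈ blockSites (L ^ j) c.1, lt x := by
    intro j hj c hcm
    have h1 := hAt_lin j hj c hcm
    rw [congrFun (congrFun (B9Eq316TowerFlatIsOneStep.linCovIter_one_left L hL At hM₀ hAtb j) c.1) c.2, hAt_eq,
      linQIter_grad L _ lt j c.1 c.2, smul_eq_zero, smul_eq_zero] at h1
    rcases h1 with h1 | h1 | h1
    · exfalso
      have : (0 : ℝ) < (((L ^ j : ℕ) : ℝ) ^ d)⁻¹ := by positivity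
      exact this.ne' h1
    · exfalso
      have : ((η⁻¹ : ℝ) : ℂ) ≠ 0 := by exact_mod_cast inv_ne_zero hη
      exact this h1
    · exact sub_eq_zero.1 h1
  -- … so — CONNECTIVITY — the flat averages `Q′_j(1)λ̃` are ONE constant `c` on every constraint family
  obtain ⟨c, hcavg⟩ := hconn lt hsums
  have hQ'lt : ∀ j, j ≤ m → ∀ y ∈ Λ j, QprimeIter (zdBlocking d L) (bgT L (1 : Site d → Fin d → 𝔸ˣ)) j lt y = c := by
    intro j hj y hy
    rw [bgT_one, B7Eq214FlatQprime.QprimeIter_one_eq_sum_blockSites hL lt j y, ← Finset.smul_sum]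
    exact hcavg j hj y hy
  have hSy : ∀ y ∈ Λ j₀, ∑ x ∈ blockSites (L ^ j₀) y, lt x = ((L : ℝ) ^ (j₀ * d)) • c := by
    intro y hy
    rw [← hcavg j₀ hj₀ y hy, smul_smul, mul_inv_cancel₀ (pow_ne_zero _ hLpos.ne'), one_smul]
  -- (H) the quasi-periodicity constants: `λ̃(x + P•n) = R(h_n)λ̃(x) + λ̃(P•n)` and `λ̃(P•n) = c − R(h_n)c`
  have hlt_per : ∀ (x n : Site d), lt (x + (P : ℤ) • n) = conjR (h n) (lt x) + lt ((P : ℤ) • n) := by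
    intro x n
    have hstep : ∀ (z : Site d) (κ : Fin d),
        lt (z + e κ + (P : ℤ) • n) - conjR (h n) (lt (z + e κ)) = lt (z + (P : ℤ) • n) - conjR (h n) (lt z) := by
      intro z κ
      have h1 := hgrad (z + (P : ℤ) • n) κ
      have h2 := hgrad z κ
      rw [add_right_comm] at h1
      have e1 : lt (z + e κ + (P : ℤ) • n) = lt (z + (P : ℤ) • n) + η • At (z + (P : ℤ) • n) κ := by
        rw [← h1]; abel
      have e2 : lt (z + e κ) = lt z + η • At z κ := by rw [← h2]; abel
      rw [e1, e2, conjR_add, conjR_smul_real, hAt_per]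
      abel
    have := eq_of_forall_step_eq (fun z => lt (z + (P : ℤ) • n) - conjR (h n) (lt z)) hstep x
    simp only [zero_add, hlt0, conjR_zero', sub_zero] at this
    rw [← this]
    abel
  have hltPn : ∀ n : Site d, lt ((P : ℤ) • n) = c - conjR (h n) c := by
    intro n
    set N : ℕ := L ^ j₀ with hN
    set Q : ℕ := P / L ^ j₀ with hQ
    have hPQ : (P : ℤ) = (N : ℤ) * (Q : ℤ) := by
      rw [hN, hQ]; exact_mod_cast (Nat.mul_div_cancel' hdvd).symm
    -- `S(y₀ + Q•n) = R(h_n)S(y₀) + Nᵈ·λ̃(P•n)`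
    have h1 : ∑ x ∈ blockSites N (y₀ + (Q : ℤ) • n), lt x = conjR (h n) (∑ x ∈ blockSites N y₀, lt x) + (N ^ d : ℕ) • lt ((P : ℤ) • n) := by
      have h0 := sum_blockSites_add_smul N (Q : ℤ) y₀ n lt
      rw [← hPQ] at h0
      rw [h0]
      simp_rw [hlt_per _ n]
      rw [Finset.sum_add_distrib, B8Ineq132.conjR_sum, Finset.sum_const, Literature.MathematicalPhysics.QuantumLattice.card_blockSites]
    rw [hN, hSy _ (hy₀per n), hSy _ hy₀] at h1
    -- solve for `λ̃(P•n)`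
    have hNd : ((((L ^ j₀) ^ d : ℕ) : ℝ)) ≠ 0 := by positivity
    have hNd' : ((((L ^ j₀) ^ d : ℕ) : ℝ)) = (L : ℝ) ^ (j₀ * d) := by push_cast; rw [← pow_mul]
    have h2 : ((L ^ j₀) ^ d : ℕ) • lt ((P : ℤ) • n) = ((L : ℝ) ^ (j₀ * d)) • c - conjR (h n) (((L : ℝ) ^ (j₀ * d)) • c) := by
      rw [eq_sub_iff_add_eq, add_comm, ← h1]
    have h3 : lt ((P : ℤ) • n) = ((((L ^ j₀) ^ d : ℕ) : ℝ)⁻¹ : ℝ) • (((L : ℝ) ^ (j₀ * d)) • c - conjR (h n) (((L : ℝ) ^ (j₀ * d)) • c)) := by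
      rw [← h2, ← Nat.cast_smul_eq_nsmul ℝ, smul_smul, inv_mul_cancel₀ hNd, one_smul]
    rw [h3, conjR_smul_real, ← smul_sub, hNd', smul_smul, inv_mul_cancel₀ (pow_ne_zero _ hLpos.ne'), one_smul]
  -- `μ := λ̃ − c` is exactly covariant
  set μf : Site d → 𝔸 := fun x => lt x - c with hμf
  have hμ_per : ∀ (x n : Site d), μf (x + (P : ℤ) • n) = conjR (h n) (μf x) := by
    intro x n
    simp only [hμf]
    rw [hlt_per, hltPn, conjR_sub]
    abel
  have hcS : c ∈ selfAdjoint 𝔸 := by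
    have hS0 : IsSelfAdjoint (∑ x ∈ blockSites (L ^ j₀) y₀, lt x) := by
      rw [IsSelfAdjoint, star_sum]
      exact Finset.sum_congr rfl fun x _ => (hltS x).star_eq
    rw [← hcavg j₀ hj₀ y₀ hy₀]
    exact smul_real_mem_selfAdjoint _ hS0
  have hμ_sa : ∀ x, IsSelfAdjoint (μf x) := fun x => (hltS x).sub hcS
  have hμ_null : ∀ j, j ≤ m → ∀ y ∈ Λ j, QprimeIter (zdBlocking d L) (bgT L (1 : Site d → Fin d → 𝔸ˣ)) j μf y = 0 := by
    intro j hj y hy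
    haveI : NeZero L := ⟨by omega⟩
    have hsplit : μf = fun x => lt x + (fun _ : Site d => -c) x := by
      funext x; simp only [hμf, sub_eq_add_neg]
    rw [hsplit, QprimeIter_add]
    show QprimeIter (zdBlocking d L) (bgT L 1) j lt y + QprimeIter (zdBlocking d L) (bgT L 1) j (fun _ => -c) y = 0
    rw [hQ'lt j hj y hy, B9Eq324DeltaPrimeAZdPer.qprimeIter_one_const hL (-c) j y, add_neg_cancel]
  -- (I) gauge back: `μ^g := R(u)⁻¹μ` is a periodic element of `N_𝔤^per(Q′(U₀))`
  set μg : Site d → 𝔸 := fun x => conjR (u⁻¹ x) (μf x) with hμg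
  have hμg_per : IsPeriodic P μg := by
    intro x n
    simp only [hμg, Pi.inv_apply]
    rw [hμ_per, huper, B8Ineq132.conjR_conjR, mul_inv_rev, inv_mul_cancel_right]
  have hμg_sa : ∀ x, IsSelfAdjoint (μg x) := fun x => B9Eq333ProjectionCovarianceZd.isSelfAdjoint_conjR (huinvU x) (hμ_sa x)
  have hμg_null : μg ∈ gaugeNullPer P L m Λ U₀ := by
    refine ⟨hμg_sa, hμg_per, fun j hj y hy => ?_⟩
    rw [hU₀eq, B9Eq333ProjectionCovarianceZd.QprimeIter_gaugeAct L u⁻¹ (1 : Site d → Fin d → 𝔸ˣ) j μf y, hμ_null j hj y hy, conjR_zero']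
  -- (J) `Δ^η_{U₀}μ^g = D^{η*}_{U₀}A`, so the Landau condition (b) kills `D^{η*}_{U₀}A`
  have hlap : ∀ x : Site d, covLap η U₀ μg x = covDivB η U₀ A x := by
    intro x
    have h1 := B8Ineq159GaugeCovariance.covLap_gaugeAct η u⁻¹ (1 : Site d → Fin d → 𝔸ˣ) μf x
    rw [← hU₀eq] at h1
    have h2 : covLap η (1 : Site d → Fin d → 𝔸ˣ) μf x = covDivB η (1 : Site d → Fin d → 𝔸ˣ) At x := by
      simp only [covLap, hμf, B9Thm311FlatKernelZdPer.covDerivFwd_one_sub_const, hgrad']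
    have h3 := B8Ineq159GaugeCovariance.covDivB_gaugeAct η u U₀ A x
    rw [hpure] at h3
    show covLap η U₀ (fun z => conjR (u⁻¹ z) (μf z)) x = covDivB η U₀ A x
    rw [h1, h2, show (fun z κ => conjR (u z) (A z κ)) = At from rfl] at *
    rw [h3, Pi.inv_apply, B8Ineq132.conjR_conjR, inv_mul_cancel, B8Ineq132.one_conjR]
  have hdivA : covDivB η U₀ A = 0 := by
    have hmem : (⟨covDivB η U₀ A, isPeriodic_covDivB hU hA.1⟩ : perSub (𝔸 := 𝔸) (d := d) P) ∈ rangeSubPer P L m η Λ U₀ := by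
      have hgen := covLap_mem_rangeGenPer (η := η) hU hμg_null
      have heq : (⟨covLap η U₀ μg, B9Eq321LandauProjectionZdPer.covLap_mem_perSub hU hμg_null.2.1⟩ : perSub (𝔸 := 𝔸) (d := d) P) =
          ⟨covDivB η U₀ A, isPeriodic_covDivB hU hA.1⟩ := Subtype.ext (funext hlap)
      rw [← heq]
      exact Submodule.subset_span hgen
    have hproj := B9Thm311FlatPositivityZdPer.projRPer_covDivB_eq_coe τ P L m η Λ hU hA.1
    rw [hb, projEPer_apply_of_mem_range L m η Λ U₀ hτs hτp hmem] at hproj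
    exact hproj.symm
  have hlap0 : ∀ x, covLap η U₀ μg x = 0 := fun x => by rw [hlap, hdivA, Pi.zero_apply]
  -- (K) the energy identity on the cell: `D^η_{U₀}μ^g = 0`
  have hB : ∀ v ∈ unitaryUnits 𝔸, ∀ a b : 𝔸, tauForm τ (conjR v a) b = tauForm τ a (conjR v⁻¹ b) :=
    fun v hv a b => by rw [tauForm_apply, tauForm_apply]; exact B9Eq326GaugeTermSquareZd.re_trace_star_pair_invariant τ hτt hv a b
  have henergy : ∑ κ : Fin d, ∑ x ∈ box (d := d) P, tauForm τ (covDerivFwd η U₀ κ μg x) (covDerivFwd η U₀ κ μg x) =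
      ∑ x ∈ box (d := d) P, tauForm τ (μg x) (covLap η U₀ μg x) := by
    have hsplit : ∀ x, tauForm τ (μg x) (covLap η U₀ μg x) =
        ∑ κ : Fin d, tauForm τ (μg x) (covDeriv η U₀ κ (fun z => covDerivFwd η U₀ κ μg z) x) := by
      intro x
      simp only [covLap, covDivB, map_sum]
    calc ∑ κ : Fin d, ∑ x ∈ box (d := d) P, tauForm τ (covDerivFwd η U₀ κ μg x) (covDerivFwd η U₀ κ μg x)
        = ∑ κ : Fin d, ∑ x ∈ box (d := d) P, tauForm τ (μg x) (covDeriv η U₀ κ (fun z => covDerivFwd η U₀ κ μg z) x) :=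
          Finset.sum_congr rfl fun κ _ =>
            sum_box_pair_covDerivFwd_left (tauForm τ) (unitaryUnits 𝔸) P η U₀ hB κ (fun x => hU₀ x κ) hU hμg_per
              (isPeriodic_covDerivFwd η hU κ hμg_per)
      _ = ∑ x ∈ box (d := d) P, ∑ κ : Fin d, tauForm τ (μg x) (covDeriv η U₀ κ (fun z => covDerivFwd η U₀ κ μg z) x) := Finset.sum_comm
      _ = ∑ x ∈ box (d := d) P, tauForm τ (μg x) (covLap η U₀ μg x) := Finset.sum_congr rfl fun x _ => (hsplit x).symm
  have hDμg : ∀ (κ : Fin d) (x : Site d), covDerivFwd η U₀ κ μg x = 0 := by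
    have nn := B9Thm311FlatHermKernelZd.re_trace_star_mul_self_nonneg' (τ := τ) hτp
    have hz : ∑ κ : Fin d, ∑ x ∈ box (d := d) P, tauForm τ (covDerivFwd η U₀ κ μg x) (covDerivFwd η U₀ κ μg x) = 0 := by
      rw [henergy]
      exact Finset.sum_eq_zero fun x _ => by rw [hlap0, map_zero]
    simp only [tauForm_apply] at hz
    intro κ x
    have hper := isPeriodic_covDerivFwd η hU κ hμg_per
    rw [← hper.apply_tlift x]
    have h1 := (Finset.sum_eq_zero_iff_of_nonneg fun κ _ => Finset.sum_nonneg fun x _ => nn _).1 hz κ (Finset.mem_univ κ)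
    have h2 := (Finset.sum_eq_zero_iff_of_nonneg fun x _ => nn _).1 h1 _ (tlift_mem_box (tcls P x))
    exact B9Thm311FlatHermKernelZd.eq_zero_of_re_trace_star_mul_self_eq_zero hτp h2
  -- (L) `A = D^η_{U₀}μ^g = 0`
  funext x κ
  have h1 := B9Eq340HolderZd.covDerivFwd_gaugeAct η u⁻¹ (1 : Site d → Fin d → 𝔸ˣ) κ (F := μf) (Fu := μg) (fun z => rfl) x
  rw [← hU₀eq, hDμg] at h1
  have h2 : covDerivFwd η (1 : Site d → Fin d → 𝔸ˣ) κ μf x = At x κ := by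
    simp only [hμf]
    rw [B9Thm311FlatKernelZdPer.covDerivFwd_one_sub_const, hgrad']
  rw [h2, hAt, Pi.inv_apply, B8Ineq132.conjR_conjR, inv_mul_cancel, B8Ineq132.one_conjR] at h1
  rw [← h1, Pi.zero_apply, Pi.zero_apply]

end Kernel

/-! ## §2  The genuine periodic record `opsAllZdPer` at a flat background with arbitrary holonomy — GENERAL class `𝔅`, connected constraint graph -/

section Record

variable {𝔸 : Type*} [CStarAlgebra 𝔸] (τ : 𝔸 →ₗ[ℂ] ℂ) [FiniteDimensional ℝ 𝔸] [Nontrivial 𝔸] {L : ℕ} (P : ℕ) [NeZero P]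

open B9SupplySockB9P3ZdAllLettersZdPer (opsAllZdPer opsLandauPer regularAtHPer_opsAllZdPer_of_pos)
open B9SupplySockB9P3ZdGammaInAkDpZd (withDpZd)
open B9Eq316AveragingTransposeZdPrinted (withQQP)
open B9Eq326DeltaAPeriodicLettersZd (linCovIter_add_period)
open B7Prop1Local (InBox loK bondHiK)
open B9Thm311FlatHolonomyKernelZdPer (plaqCovDeriv_eq_zero_of_lt_of_mem_box)

omit [CStarAlgebra 𝔸] [FiniteDimensional ℝ 𝔸] [Nontrivial 𝔸] [NeZero P] in
/-- `P = Lʲ·(P ∕ Lʲ)` over `ℤ` for `Lʲ ∣ P`. [folklore] -/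
private theorem cast_eq_pow_mul_div'' {j : ℕ} (hdvd : L ^ j ∣ P) : (P : ℤ) = (L : ℤ) ^ j * ((P / L ^ j : ℕ) : ℤ) := by
  exact_mod_cast (Nat.mul_div_cancel' hdvd).symm

omit [CStarAlgebra 𝔸] [FiniteDimensional ℝ 𝔸] [Nontrivial 𝔸] in
/-- the coarse period `P ∕ Lʲ` is non-zero. [folklore] -/
private theorem neZero_div'' {j : ℕ} (hdvd : L ^ j ∣ P) : NeZero (P / L ^ j) := by
  refine ⟨(Nat.div_pos (Nat.le_of_dvd (Nat.pos_of_ne_zero (NeZero.ne P)) hdvd) ?_).ne'⟩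
  rcases Nat.eq_zero_or_pos (L ^ j) with h0 | hpos
  · exfalso
    have : (0 : ℕ) ∣ P := by rw [← h0]; exact hdvd
    exact NeZero.ne P (Nat.eq_zero_of_zero_dvd this)
  · exact hpos

/-- ★★★ **[B9] THEOREM 3.11 AT EVERY FLAT PERIODIC BACKGROUND — THE KERNEL FOR THE GENUINE RECORD OVER A GENERAL CLASS** (any member `i`, truncation `m` with
`Lᵐ ∣ P`, any bond class `𝔅 m j` with `(P∕Lʲ)`-periodic `κ`-sections and the box law «box ⊂ Ω_{j−1}», whose constraint graph with the families `i.Λs m` is CONNECTED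
(`hconn`) and which carries a periodic constraint label `y₀`): for the genuine periodic record `opsAllZdPer τ L P 𝔅 ops₀ M i m`, a `P`-periodic unitary `U₀` with EVERY
PLAQUETTE VARIABLE `1` (ANY holonomy) and `A ∈ E_𝔤^per(P)` with `⟨A, Δ_a(U₀)A⟩_per ≤ 0`: `A = 0` — the lineage's flat-holonomy kernel conditions (p648517, generic in the
class) upgraded to all of `ℤᵈ` by periodicity, then §1.
[cite: Balaban1985BackgroundPropagators, Thm 3.11 p.416, (3.26)–(3.27) p.395; Balaban1984PropagatorsI, (1.72) p.30; Balaban1985RegularSpaces, (1.5) p.77, (1.31) p.82, p.77 («Ω_j ⊂ T_η»)] -/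
theorem eq_zero_of_flat_of_bondPairPer_deltaAOf_opsAllZdPer_nonpos_of_connected (hτt : ∀ a b : 𝔸, τ (a * b) = τ (b * a))
    (hτs : ∀ a : 𝔸, τ (star a) = starRingEnd ℂ (τ a)) (hτp : ∀ a : 𝔸, a ≠ 0 → 0 < (τ (star a * a)).re)
    (hL : 2 ≤ L) (ops₀ : ℝ → ZdIdx d L → ℕ → OpsZd d 𝔸) (M : ℝ) (i : ZdIdx d L) {m : ℕ} {𝔅 : ℕ → ℕ → Set (Site d × Fin d)}
    (h𝔅per : ∀ j, j ≤ m → ∀ κ : Fin d, IsPeriodic (P / L ^ j) (fun z => (z, κ) ∈ 𝔅 m j))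
    (hbox : ∀ j, j ≤ m → ∀ c ∈ 𝔅 m j, ∀ x, InBox (loK L j c.1) (bondHiK L j c.1 c.2) x → x ∈ i.Ω (j - 1))
    (hconn : ∀ lam : Site d → 𝔸,
      (∀ j, j ≤ m → ∀ c ∈ 𝔅 m j, ∑ x ∈ blockSites (L ^ j) (c.1 + e c.2), lam x = ∑ x ∈ blockSites (L ^ j) c.1, lam x) →
      ∃ a : 𝔸, ∀ j, j ≤ m → ∀ y ∈ i.Λs m j, ((L : ℝ) ^ (j * d))⁻¹ • ∑ x ∈ blockSites (L ^ j) y, lam x = a)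
    {j₀ : ℕ} (hj₀ : j₀ ≤ m) {y₀ : Site d} (hy₀ : y₀ ∈ i.Λs m j₀) (hy₀per : ∀ n : Site d, y₀ + ((P / L ^ j₀ : ℕ) : ℤ) • n ∈ i.Λs m j₀)
    (hdvd : L ^ m ∣ P) {U₀ : Site d → Fin d → 𝔸ˣ} (hU₀ : ∀ x κ, U₀ x κ ∈ unitaryUnits 𝔸) (hU : IsPeriodic P U₀)
    (hflat : ∀ (κ ν : Fin d) (x : Site d), plaqF U₀ κ ν x = 1)
    {A : Site d → Fin d → 𝔸} (hA : A ∈ domSubHPer (d := d) (𝔸 := 𝔸) P)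
    (h : bondPairPer τ P A (deltaAOf i.η (opsAllZdPer τ L P 𝔅 ops₀ M i m) U₀ A) ≤ 0) : A = 0 := by
  have hL1 : 1 ≤ L := le_trans (by norm_num) hL
  obtain ⟨hflatA, hR, havg⟩ := B9Eq316AveragingSquaresZdPer.kernel_conditions_per_of_flat_of_bondPairPer_nonpos τ P hτt hτs hτp hL 𝔅 ops₀ M i
    hdvd h𝔅per hbox hU₀ hU hflat hA.1 h
  -- (a) everywhere
  have ha := plaqCovDeriv_eq_zero_of_lt_of_mem_box P hU hA.1 hflatA
  -- (c) at every class bond of every level `j ≤ m`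
  have hc : ∀ j, j ≤ m → ∀ c ∈ 𝔅 m j, linCovIter L U₀ A j c.1 c.2 = 0 := by
    intro j hj c hcm
    have hdvdj : L ^ j ∣ P := (pow_dvd_pow L hj).trans hdvd
    haveI := neZero_div'' P hdvdj
    have hper : IsPeriodic (P / L ^ j) (fun z => linCovIter L U₀ A j z c.2) := fun z n =>
      linCovIter_add_period hU hA.1 (cast_eq_pow_mul_div'' P hdvdj) z n c.2
    rw [← hper.apply_tlift c.1]
    refine havg j hj c.2 _ (tlift_mem_box _) ?_
    rw [(h𝔅per j hj c.2).apply_tlift c.1]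
    exact hcm
  exact eq_zero_of_flat_holonomy_kernel_of_connected τ P hτt hτs hτp hL1 i.hη.ne' (i.Λs m) (𝔅 m) hconn hj₀ ((pow_dvd_pow L hj₀).trans hdvd)
    hy₀ hy₀per hU₀ hU hflat hA ha hR hc

/-- ★★★ **POSITIVE DEFINITENESS OF THE GENUINE `Δ_a(U₀)` AT EVERY FLAT PERIODIC BACKGROUND, GENERAL CLASS** (same hypotheses): `0 ≠ A ∈ E_𝔤^per(P)` ⟹
`0 < ⟨A, Δ_a(U₀)A⟩_per` — [B9] Theorem 3.11's «Δ_a positive definite» at all flat backgrounds, trivial AND non-trivial holonomy, of a nested periodic member.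
[cite: Balaban1985BackgroundPropagators, Thm 3.11 p.416, (3.26)–(3.27) p.395; Balaban1985RegularSpaces, (1.7) p.77, (1.5) p.77, (1.31) p.82] -/
theorem bondPairPer_deltaAOf_opsAllZdPer_pos_of_flat_of_connected (hτt : ∀ a b : 𝔸, τ (a * b) = τ (b * a))
    (hτs : ∀ a : 𝔸, τ (star a) = starRingEnd ℂ (τ a)) (hτp : ∀ a : 𝔸, a ≠ 0 → 0 < (τ (star a * a)).re)
    (hL : 2 ≤ L) (ops₀ : ℝ → ZdIdx d L → ℕ → OpsZd d 𝔸) (M : ℝ) (i : ZdIdx d L) {m : ℕ} {𝔅 : ℕ → ℕ → Set (Site d × Fin d)}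
    (h𝔅per : ∀ j, j ≤ m → ∀ κ : Fin d, IsPeriodic (P / L ^ j) (fun z => (z, κ) ∈ 𝔅 m j))
    (hbox : ∀ j, j ≤ m → ∀ c ∈ 𝔅 m j, ∀ x, InBox (loK L j c.1) (bondHiK L j c.1 c.2) x → x ∈ i.Ω (j - 1))
    (hconn : ∀ lam : Site d → 𝔸,
      (∀ j, j ≤ m → ∀ c ∈ 𝔅 m j, ∑ x ∈ blockSites (L ^ j) (c.1 + e c.2), lam x = ∑ x ∈ blockSites (L ^ j) c.1, lam x) →
      ∃ a : 𝔸, ∀ j, j ≤ m → ∀ y ∈ i.Λs m j, ((L : ℝ) ^ (j * d))⁻¹ • ∑ x ∈ blockSites (L ^ j) y, lam x = a)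
    {j₀ : ℕ} (hj₀ : j₀ ≤ m) {y₀ : Site d} (hy₀ : y₀ ∈ i.Λs m j₀) (hy₀per : ∀ n : Site d, y₀ + ((P / L ^ j₀ : ℕ) : ℤ) • n ∈ i.Λs m j₀)
    (hdvd : L ^ m ∣ P) {U₀ : Site d → Fin d → 𝔸ˣ} (hU₀ : ∀ x κ, U₀ x κ ∈ unitaryUnits 𝔸) (hU : IsPeriodic P U₀)
    (hflat : ∀ (κ ν : Fin d) (x : Site d), plaqF U₀ κ ν x = 1)
    {A : Site d → Fin d → 𝔸} (hA : A ∈ domSubHPer (d := d) (𝔸 := 𝔸) P) (hA0 : A ≠ 0) :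
    0 < bondPairPer τ P A (deltaAOf i.η (opsAllZdPer τ L P 𝔅 ops₀ M i m) U₀ A) := by
  by_contra hle
  exact hA0 (eq_zero_of_flat_of_bondPairPer_deltaAOf_opsAllZdPer_nonpos_of_connected τ P hτt hτs hτp hL ops₀ M i h𝔅per hbox hconn hj₀ hy₀ hy₀per
    hdvd hU₀ hU hflat hA (not_lt.1 hle))

/-- ★★ **`RegularAtHPer` AT EVERY FLAT PERIODIC BACKGROUND, GENERAL CLASS** (any holonomy): `Δ_a(U₀)` of `opsAllZdPer τ L P 𝔅 ops₀` is invertible on `E_𝔤^per(P)` —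
the lineage's `regularAtHPer_opsAllZdPer_of_pos` (p641100) fed with the flat positivity above.
[cite: Balaban1985BackgroundPropagators, Thm 3.11 p.416, (3.26)–(3.27) p.395; Balaban1985RegularSpaces, (1.58) p.86, (1.5) p.77, (1.31) p.82] -/
theorem regularAtHPer_opsAllZdPer_of_flat_of_connected (hτt : ∀ a b : 𝔸, τ (a * b) = τ (b * a))
    (hτs : ∀ a : 𝔸, τ (star a) = starRingEnd ℂ (τ a)) (hτp : ∀ a : 𝔸, a ≠ 0 → 0 < (τ (star a * a)).re)
    (hL : 2 ≤ L) (ops₀ : ℝ → ZdIdx d L → ℕ → OpsZd d 𝔸) (M : ℝ) (i : ZdIdx d L) {m : ℕ} {𝔅 : ℕ → ℕ → Set (Site d × Fin d)}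
    (h𝔅per : ∀ j, j ≤ m → ∀ κ : Fin d, IsPeriodic (P / L ^ j) (fun z => (z, κ) ∈ 𝔅 m j))
    (hbox : ∀ j, j ≤ m → ∀ c ∈ 𝔅 m j, ∀ x, InBox (loK L j c.1) (bondHiK L j c.1 c.2) x → x ∈ i.Ω (j - 1))
    (hconn : ∀ lam : Site d → 𝔸,
      (∀ j, j ≤ m → ∀ c ∈ 𝔅 m j, ∑ x ∈ blockSites (L ^ j) (c.1 + e c.2), lam x = ∑ x ∈ blockSites (L ^ j) c.1, lam x) →
      ∃ a : 𝔸, ∀ j, j ≤ m → ∀ y ∈ i.Λs m j, ((L : ℝ) ^ (j * d))⁻¹ • ∑ x ∈ blockSites (L ^ j) y, lam x = a)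
    {j₀ : ℕ} (hj₀ : j₀ ≤ m) {y₀ : Site d} (hy₀ : y₀ ∈ i.Λs m j₀) (hy₀per : ∀ n : Site d, y₀ + ((P / L ^ j₀ : ℕ) : ℤ) • n ∈ i.Λs m j₀)
    (hdvd : L ^ m ∣ P) {U₀ : Site d → Fin d → 𝔸ˣ} (hU₀ : ∀ x κ, U₀ x κ ∈ unitaryUnits 𝔸) (hU : IsPeriodic P U₀)
    (hflat : ∀ (κ ν : Fin d) (x : Site d), plaqF U₀ κ ν x = 1) :
    RegularAtHPer i.η (opsLandauPer τ P (withDpZd (withQQP τ L 𝔅 ops₀)) M i m) P U₀ :=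
  regularAtHPer_opsAllZdPer_of_pos τ P hL hτp hτt hτs 𝔅 ops₀ M i hU₀ hU hdvd h𝔅per (fun j _ hj => hbox j hj)
    (fun _ hA hA0 => bondPairPer_deltaAOf_opsAllZdPer_pos_of_flat_of_connected τ P hτt hτs hτp hL ops₀ M i h𝔅per hbox hconn hj₀ hy₀ hy₀per
      hdvd hU₀ hU hflat hA hA0)

end Record

/-! ## §3  On the periodic index of record `IdxB8SubDPer θ P`: print's class `towerBondsP`, every member, every truncation `m ≤ k` — NO displayed binder -/

section Members

open B9SupplySockB9P3ZdAllLettersZdPer (opsAllZdPer opsLandauPer)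
open B9SupplySockB9P3ZdGammaInAkDpZd (withDpZd)
open B9Eq316AveragingTransposeZdPrinted (withQQP)
open B7Prop1Local (InBox loK bondHiK)
open B8Ineq132 (Under layer)
open B9Eq325QGGQInvZdPer (InSat QprimeStarPerInjective inSat_iff_mem neZero_div_pow)
open Literature.MathematicalPhysics.QuantumLattice (blockMap)
open B8Eq15ClassGraphConnectedZd (mem_layer_of_under_of_mem_lamK level_eq_of_mem_layer exists_lamK_under)
open B8Eq191FlatLettersCubeMember (under_iff_blockMap_eq)

variable {θ : Stage3Params} [FiniteDimensional ℝ θ.𝔸] (τ : θ.𝔸 →ₗ[ℂ] ℂ) {P : ℕ} [NeZero P]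

/-- `1 ≤ θ.L` (Bałaban's `L ≥ 2`; private plumbing). [folklore] -/
private theorem one_le_L (θ : Stage3Params) : 1 ≤ θ.L := le_trans (by norm_num) θ.two_le_L

omit [FiniteDimensional ℝ θ.𝔸] [NeZero P] in
/-- **THE `κ`-SECTIONS OF PRINT'S CLASS OVER A PERIODIC MEMBER'S FAMILIES ARE LEVEL-PERIODIC** (`(P∕Lʲ)`-periodic at level `j ≤ m ≤ k`; dag-n05-w2's
`B8PeriodicMemberGeometry.IdxB8SubD.isPeriodic_towerBondsP_Λs` with the tiling law `Lʲ·(P∕Lʲ) = P`). [cite: Balaban1985RegularSpaces, (1.31) p.82, (1.5) p.77, p.77 («Ω_j ⊂ T_η»)] -/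
theorem IdxB8SubDPer.isPeriodic_towerBondsP_Λs (a : IdxB8SubDPer θ P) {m : ℕ} (hm : m ≤ a.toZdIdx.k) {j : ℕ} (hj : j ≤ m) (κ : Fin θ.D) :
    IsPeriodic (P / θ.L ^ j) (fun z => (z, κ) ∈ towerBondsP θ.L a.toZdIdx.Ω (a.toZdIdx.Λs m) j) :=
  B8PeriodicMemberGeometry.IdxB8SubD.isPeriodic_towerBondsP_Λs a.1 (fun l _ => a.periodic l) hm hj (a.pow_mul_div (hj.trans hm)).symm κ

omit [FiniteDimensional ℝ θ.𝔸] [NeZero P] in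
/-- **THE BOX LAW «box ⊂ Ω_{j−1}» OF PRINT'S CLASS AT A MEMBER** (dag-n05-d's `towerBondsP_box_subset_pred` over the nested `Ω`). [cite: Balaban1985RegularSpaces, (1.31) p.82, (1.42) p.83] -/
theorem IdxB8SubDPer.towerBondsP_box (a : IdxB8SubDPer θ P) (m : ℕ) :
    ∀ j, j ≤ m → ∀ c ∈ towerBondsP θ.L a.toZdIdx.Ω (a.toZdIdx.Λs m) j, ∀ x, InBox (loK θ.L j c.1) (bondHiK θ.L j c.1 c.2) x → x ∈ a.toZdIdx.Ω (j - 1) :=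
  fun _ _ _ hc => B8TowerBondsPrinted.towerBondsP_box_subset_pred θ.L a.toZdIdx.hΩ (a.toZdIdx.Λs m) hc

omit [FiniteDimensional ℝ θ.𝔸] [NeZero P] in
/-- **A PERIODIC CONSTRAINT LABEL EXISTS AT EVERY TRUNCATION** (the block of the partition through the origin, (1.6); its period translates are constraint labels
by the towers' periodicity). [cite: Balaban1985RegularSpaces, (1.6) p.77, p.77 («Ω_j ⊂ T_η»)] -/
theorem IdxB8SubDPer.exists_periodic_label (a : IdxB8SubDPer θ P) {m : ℕ} (hm : m ≤ a.toZdIdx.k) :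
    ∃ j₀, j₀ ≤ m ∧ ∃ y₀ ∈ a.toZdIdx.Λs m j₀, ∀ n : Site θ.D, y₀ + ((P / θ.L ^ j₀ : ℕ) : ℤ) • n ∈ a.toZdIdx.Λs m j₀ := by
  obtain ⟨l, hl, y, hy, -⟩ := exists_lamK_under (one_le_L θ) a.domainSeq a.Ω_zero m (0 : Site θ.D)
  rw [← a.Λs_eq_lam hm hl] at hy
  exact ⟨l, hl, y, hy, fun n => (a.mem_Λs_add_smul_iff hm hl y n).2 hy⟩

omit [FiniteDimensional ℝ θ.𝔸] [NeZero P] in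
/-- **THE CONSTRAINT BLOCKS OF A MEMBER ARE DISJOINT ACROSS LEVELS, IN THE PERIODIC READING** (the hypothesis of §0's `qprimeStarPerInjective_of_disjoint_levels` at
`Λs := a.Λs m`): a fine site whose level-`j` and level-`j′` labels are both constraint labels has `j = j′` — (1.5)'s layers are disjoint
(`B8Eq15ClassGraphConnectedZd.level_eq_of_mem_layer`). [cite: Balaban1985RegularSpaces, (1.5)–(1.6) p.77, p.77 («Ω_j ⊂ T_η»)] -/
theorem IdxB8SubDPer.level_eq_of_inSat_blockMap (a : IdxB8SubDPer θ P) {m : ℕ} (hm : m ≤ a.toZdIdx.k) (x : Site θ.D) (j j' : ℕ) (hj : j ≤ m)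
    (hj' : j' ≤ m) (h : InSat P θ.L (a.toZdIdx.Λs m) j (blockMap (θ.L ^ j) x)) (h' : InSat P θ.L (a.toZdIdx.Λs m) j' (blockMap (θ.L ^ j') x)) : j = j' := by
  haveI : NeZero P := ⟨a.pos.ne'⟩
  have hL1 := one_le_L θ
  -- the periodic reading is membership; the member's families are print's level sets
  have key : ∀ {l : ℕ}, l ≤ m → InSat P θ.L (a.toZdIdx.Λs m) l (blockMap (θ.L ^ l) x) → x ∈ layer a.toZdIdx.Ω m l := by
    intro l hl hsat
    haveI := neZero_div_pow (P := P) (L := θ.L) (a.dvd_level hm) hl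
    have hper : IsPeriodic (P / θ.L ^ l) fun y => y ∈ a.toZdIdx.Λs m l := a.isPeriodic_Λs hm hl
    have h1 : blockMap (θ.L ^ l) x ∈ a.toZdIdx.Λs m l := (inSat_iff_mem (P := P) (L := θ.L) (Λs := a.toZdIdx.Λs m) hper _).1 hsat
    have e : a.toZdIdx.Λs m l = B11Eq7Convention.Lam θ.L a.toZdIdx.Ω m l := a.Λs_eq_lam hm hl
    rw [e] at h1
    exact mem_layer_of_under_of_mem_lamK hL1 a.domainSeq h1 ((under_iff_blockMap_eq hL1 l _ x).2 rfl)
  exact level_eq_of_mem_layer a.domainSeq hj hj' (key hj h) (key hj' h')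

omit [FiniteDimensional ℝ θ.𝔸] [NeZero P] in
/-- ★★ **«`Q′` IS ONTO» AT EVERY PERIODIC MEMBER, EVERY TRUNCATION `m ≤ k`, EVERY BACKGROUND OF UNITS** — the displayed hypothesis `QprimeStarPerInjective` of the
(3.25) ∕ `Q′G′²Q′*` road holds over `a.Λs m` with no condition on `U₀` (§0 + the disjointness above).
[cite: Balaban1985BackgroundPropagators, (3.18)–(3.19) p.393, (3.25) p.394; Balaban1985RegularSpaces, (1.5)–(1.6) p.77] -/
theorem IdxB8SubDPer.qprimeStarPerInjective (a : IdxB8SubDPer θ P) {m : ℕ} (hm : m ≤ a.toZdIdx.k) (U₀ : Site θ.D → Fin θ.D → θ.𝔸ˣ) :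
    QprimeStarPerInjective (𝔸 := θ.𝔸) P θ.L U₀ m (a.toZdIdx.Λs m) := by
  haveI : NeZero P := ⟨a.pos.ne'⟩
  haveI : NeZero θ.L := ⟨by have := θ.two_le_L; omega⟩
  exact qprimeStarPerInjective_of_disjoint_levels (a.dvd_level hm) fun x j j' hj hj' h h' => IdxB8SubDPer.level_eq_of_inSat_blockMap a hm x j j' hj hj' h h'

/-- ★★★ **[B9] THEOREM 3.11 AT EVERY FLAT PERIODIC BACKGROUND, EVERY NESTED PERIODIC MEMBER — THE KERNEL FOR THE GENUINE RECORD OVER PRINT'S CLASS**: at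
`a : IdxB8SubDPer θ P`, truncation `m ≤ k`, for the record `opsAllZdPer τ θ.L P (towerBondsP θ.L Ω (Λs ·) ·) ops₀ M a m`, a `P`-periodic unitary `U₀` with every
plaquette variable `1` (ANY holonomy) and `A ∈ E_𝔤^per(P)` with `⟨A, Δ_a(U₀)A⟩_per ≤ 0`: `A = 0` — §2 with the member's laws: class periodicity, box law, the
CONNECTIVITY of `B8Eq15ClassGraphConnectedZd`, a periodic label, `Lᵐ ∣ P`.  NO displayed binder.
[cite: Balaban1985BackgroundPropagators, Thm 3.11 p.416, (3.26)–(3.27) p.395; Balaban1984PropagatorsI, (1.72) p.30; Balaban1985RegularSpaces, (1.3)–(1.6) p.77, (1.31) p.82, p.77 («Ω_j ⊂ T_η»)] -/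
theorem IdxB8SubDPer.eq_zero_of_flat_of_bondPairPer_deltaAOf_opsAllZdPer_nonpos (hτt : ∀ x y : θ.𝔸, τ (x * y) = τ (y * x))
    (hτs : ∀ x : θ.𝔸, τ (star x) = starRingEnd ℂ (τ x)) (hτp : ∀ x : θ.𝔸, x ≠ 0 → 0 < (τ (star x * x)).re)
    (a : IdxB8SubDPer θ P) {m : ℕ} (hm : m ≤ a.toZdIdx.k) (ops₀ : ℝ → ZdIdx θ.D θ.L → ℕ → OpsZd θ.D θ.𝔸) (M : ℝ)
    {U₀ : Site θ.D → Fin θ.D → θ.𝔸ˣ} (hU₀ : ∀ x κ, U₀ x κ ∈ unitaryUnits θ.𝔸) (hU : IsPeriodic P U₀)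
    (hflat : ∀ (κ ν : Fin θ.D) (x : Site θ.D), plaqF U₀ κ ν x = 1)
    {A : Site θ.D → Fin θ.D → θ.𝔸} (hA : A ∈ domSubHPer (d := θ.D) (𝔸 := θ.𝔸) P)
    (h : bondPairPer τ P A (deltaAOf a.toZdIdx.η
      (opsAllZdPer τ θ.L P (fun k j => towerBondsP θ.L a.toZdIdx.Ω (a.toZdIdx.Λs k) j) ops₀ M a.toZdIdx m) U₀ A) ≤ 0) : A = 0 := by
  obtain ⟨j₀, hj₀, y₀, hy₀, hy₀per⟩ := IdxB8SubDPer.exists_periodic_label a hm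
  exact eq_zero_of_flat_of_bondPairPer_deltaAOf_opsAllZdPer_nonpos_of_connected τ P hτt hτs hτp θ.two_le_L ops₀ M a.toZdIdx
    (𝔅 := fun k j => towerBondsP θ.L a.toZdIdx.Ω (a.toZdIdx.Λs k) j) (fun j hj κ => IdxB8SubDPer.isPeriodic_towerBondsP_Λs a hm hj κ) (IdxB8SubDPer.towerBondsP_box a m)
    (fun lam hinv => B8Eq15ClassGraphConnectedZd.IdxB8SubDPer.exists_const_avg_of_towerBondsP a hm lam hinv) hj₀ hy₀ hy₀per (a.dvd_level hm)
    hU₀ hU hflat hA h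

/-- ★★★ **POSITIVE DEFINITENESS OF THE GENUINE `Δ_a(U₀)` AT EVERY FLAT PERIODIC BACKGROUND OF EVERY NESTED PERIODIC MEMBER** (any holonomy; print's class):
`0 ≠ A ∈ E_𝔤^per(P)` ⟹ `0 < ⟨A, Δ_a(U₀)A⟩_per` — the compact set onto which the class (1.7) shrinks as `α₀ → 0`; dag-n06-b g23's
`bondPairPer_deltaAOf_opsAllZdPer_pos_of_flat` is the all-torus member. [cite: Balaban1985BackgroundPropagators, Thm 3.11 p.416, (3.26)–(3.27) p.395; Balaban1985RegularSpaces, (1.7) p.77, (1.3)–(1.6) p.77, (1.31) p.82] -/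
theorem IdxB8SubDPer.bondPairPer_deltaAOf_opsAllZdPer_pos_of_flat (hτt : ∀ x y : θ.𝔸, τ (x * y) = τ (y * x))
    (hτs : ∀ x : θ.𝔸, τ (star x) = starRingEnd ℂ (τ x)) (hτp : ∀ x : θ.𝔸, x ≠ 0 → 0 < (τ (star x * x)).re)
    (a : IdxB8SubDPer θ P) {m : ℕ} (hm : m ≤ a.toZdIdx.k) (ops₀ : ℝ → ZdIdx θ.D θ.L → ℕ → OpsZd θ.D θ.𝔸) (M : ℝ)
    {U₀ : Site θ.D → Fin θ.D → θ.𝔸ˣ} (hU₀ : ∀ x κ, U₀ x κ ∈ unitaryUnits θ.𝔸) (hU : IsPeriodic P U₀)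
    (hflat : ∀ (κ ν : Fin θ.D) (x : Site θ.D), plaqF U₀ κ ν x = 1)
    {A : Site θ.D → Fin θ.D → θ.𝔸} (hA : A ∈ domSubHPer (d := θ.D) (𝔸 := θ.𝔸) P) (hA0 : A ≠ 0) :
    0 < bondPairPer τ P A (deltaAOf a.toZdIdx.η
      (opsAllZdPer τ θ.L P (fun k j => towerBondsP θ.L a.toZdIdx.Ω (a.toZdIdx.Λs k) j) ops₀ M a.toZdIdx m) U₀ A) := by
  by_contra hle
  exact hA0 (IdxB8SubDPer.eq_zero_of_flat_of_bondPairPer_deltaAOf_opsAllZdPer_nonpos τ hτt hτs hτp a hm ops₀ M hU₀ hU hflat hA (not_lt.1 hle))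

/-- ★★ **`RegularAtHPer` AT EVERY FLAT PERIODIC BACKGROUND OF EVERY NESTED PERIODIC MEMBER** (any holonomy; print's class; `m ≤ k`): `Δ_a(U₀)` of the genuine record
is invertible on `E_𝔤^per(P)`; dag-n06-b g23's `regularAtHPer_opsAllZdPer_of_flat_torusIdx` is the all-torus member.
[cite: Balaban1985BackgroundPropagators, Thm 3.11 p.416, (3.26)–(3.27) p.395; Balaban1985RegularSpaces, (1.58) p.86, (1.3)–(1.6) p.77, (1.31) p.82] -/
theorem IdxB8SubDPer.regularAtHPer_opsAllZdPer_of_flat (hτt : ∀ x y : θ.𝔸, τ (x * y) = τ (y * x))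
    (hτs : ∀ x : θ.𝔸, τ (star x) = starRingEnd ℂ (τ x)) (hτp : ∀ x : θ.𝔸, x ≠ 0 → 0 < (τ (star x * x)).re)
    (a : IdxB8SubDPer θ P) {m : ℕ} (hm : m ≤ a.toZdIdx.k) (ops₀ : ℝ → ZdIdx θ.D θ.L → ℕ → OpsZd θ.D θ.𝔸) (M : ℝ)
    {U₀ : Site θ.D → Fin θ.D → θ.𝔸ˣ} (hU₀ : ∀ x κ, U₀ x κ ∈ unitaryUnits θ.𝔸) (hU : IsPeriodic P U₀)
    (hflat : ∀ (κ ν : Fin θ.D) (x : Site θ.D), plaqF U₀ κ ν x = 1) :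
    RegularAtHPer a.toZdIdx.η
      (opsLandauPer τ P (withDpZd (withQQP τ θ.L (fun k j => towerBondsP θ.L a.toZdIdx.Ω (a.toZdIdx.Λs k) j) ops₀)) M a.toZdIdx m) P U₀ := by
  obtain ⟨j₀, hj₀, y₀, hy₀, hy₀per⟩ := IdxB8SubDPer.exists_periodic_label a hm
  exact regularAtHPer_opsAllZdPer_of_flat_of_connected τ P hτt hτs hτp θ.two_le_L ops₀ M a.toZdIdx
    (𝔅 := fun k j => towerBondsP θ.L a.toZdIdx.Ω (a.toZdIdx.Λs k) j) (fun j hj κ => IdxB8SubDPer.isPeriodic_towerBondsP_Λs a hm hj κ) (IdxB8SubDPer.towerBondsP_box a m)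
    (fun lam hinv => B8Eq15ClassGraphConnectedZd.IdxB8SubDPer.exists_const_avg_of_towerBondsP a hm lam hinv) hj₀ hy₀ hy₀per (a.dvd_level hm)
    hU₀ hU hflat

end Members

end Literature.MathematicalPhysics.QuantumFieldTheory.Balaban1983to89.B9Thm311FlatHolonomyKernelZdPerNested

end
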